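import Summits.Parity.GeneralizedHardyLittlewood.Theses.LeeYangFibres
import Summits.Parity.GeneralizedHardyLittlewood.Theorems.LeeYangFibresRelativeDimOneNecessityDefs
import HarnessLib

/-!
# Route `LeeYangFibres`, crux `RelativeDimOne` (stmt-Parity-14113): vocabulary of the line
`gallagher-backwards-split` (the SPLIT  crux ⟸ incidence-bandlimited core ∧ class second moment)

Route-posited objects (D-0016 `<Route><Crux>Defs` file) shared by the registered stubs of the skeleton
`Cruxes/RelativeDimOne/Lines/gallagher_backwards_split.lean` (crux-plan seat
`planner-cruxplan-stmt-Parity-14113-gallagher-backwards--0`; line lead `prover-line-stmt-Parity-14113-1`) and by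
the crux file that composes them. NOTHING IS ASSERTED: every `def … : Prop` below is a *statement* — the
type of a registered stub (`stub_core`, `stub_lowSecondMoment`, `stub_classMoments`, `stub_cosetSingularMean`,
`stub_singularSeriesBandlimited`, `stub_rigidity`, `stub_inversion`) — consumed only as the type of a stub
theorem or as an explicit hypothesis. The identity `sys_coeffs_consts` (every `d = 1` system is `sys` of its
coefficient and shift vectors) is PROVED here and is the registered sub-goal this file lands under.

THE LINE (idea card `Cruxes/RelativeDimOne/Ideas/gallagher-backwards-split.md`, line card
`Cruxes/RelativeDimOne/Lines/gallagher-backwards-split.md`): the crux `RelativeDimOne` (the `Λ`-form of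
Green–Tao Conj. 1.4 at `d = 1`, uniformly over non-degenerate systems `ψ_i(n) = a_i n + b_i`) is deduced from
two ATOMS of different natures — `IncidenceBandlimitedCore θ` (parity content: at each scale SOME level-`N^θ`
INCIDENCE SPECTRUM reproduces every `S(Ψ, K)` to relative accuracy; an incidence spectrum sees the shifts
`b` only through the incidence type mod `q` — which `gcd(a_i,q)`, `gcd(b_i, gcd(a_i,q))`,
`gcd(a_i b_j − a_j b_i, q)` occur — exactly the data the Hardy–Littlewood local factors `β_p` depend on) and
`LowClassSecondMoment θ₁` (`L`-function content: the sharp class second moment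
`Σ_a ψ(N;q,a)² ≤ (1+ε)(N²/φ(q) + N log N)` below level `N^{θ₁}`) — through four provable statements:
`MovingClassMoments` (prime side of the dictionary), `CosetSingularMean` (Gallagher averaging of singular
series over box-cosets), `SingularSeriesBandlimited` (the singular series is itself an incidence spectrum up
to `ε`), `IncidenceRigidity` (NEW: an incidence-bandlimited function with an a-priori bound and small sums over
every box-coset is small pointwise) and the `Inversion` (the deduction). Both atoms are provably NECESSARY for
the crux (`latticeNecessity` p92797 for L; `core_of_relativeDimOne` in the skeleton for P, modulo
`SingularSeriesBandlimited`).

References: Green–Tao, Ann. of Math. 171 (2010), Conj. 1.2/1.4, (1.1)–(1.7) [GreenTao2010]; Gallagher,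
Mathematika 23 (1976), §2 [Gallagher1976]; Goldston–Suriajaya 2021 (singular series averages in progressions).
-/

noncomputable section

open scoped BigOperators Classical Topology
open Finset Filter MeasureTheory Literature.NumberTheory.Sieve
open Summit.Parity.GeneralizedHardyLittlewood.Theses.LeeYangFibres (RelativeDimOne)
open Summit.Parity.GeneralizedHardyLittlewood.Cruxes.RelativeDimOne.GallagherBackwards (classPsi)

namespace Summit.Parity.GeneralizedHardyLittlewood.Cruxes.RelativeDimOne.GallagherBackwardsSplit

variable {t : ℕ}

/-! ### Vocabulary: systems by coefficient and shift vectors, incidence types, band sums -/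

/-- The `d = 1` system with coefficient vector `a` and shift vector `b`: `ψ_i(n) = a_i n + b_i`. -/
def sys (a b : Fin t → ℤ) : Fin t → AffLinForm 1 := fun i => ⟨fun _ => a i, b i⟩

/-- Coefficient vector `(a_i)` of a `d = 1` system. -/
def coeffs (Ψ : Fin t → AffLinForm 1) : Fin t → ℤ := fun i => (Ψ i).coeff 0

/-- Shift vector `(b_i)` of a `d = 1` system. -/
def consts (Ψ : Fin t → AffLinForm 1) : Fin t → ℤ := fun i => (Ψ i).const

/-- Every `d = 1` system is `sys` of its coefficient and shift vectors (the registered sub-goal under which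
this vocabulary file lands). -/
theorem sys_coeffs_consts : ∀ {t : ℕ} (Ψ : Fin t → AffLinForm 1), sys (coeffs Ψ) (consts Ψ) = Ψ := by
  intro t Ψ
  funext i
  apply AffLinForm.ext
  · funext j
    have hj : j = 0 := Fin.fin_one_eq_zero j
    subst hj
    rfl
  · rfl

/-- INCIDENCE TYPES of `t` forms: per form the pair `(gcd(a_i, q), gcd(b_i, gcd(a_i, q)))`, per pair of
forms the gcd of the discriminant `D_ij = a_i b_j − a_j b_i` with `q`. This is exactly the residue data
the local factors `β_p`, `p ∣ q`, depend on (which forms are constant / vanish mod `p`, which roots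
coincide), it is invariant under the reparametrisation `b ↦ b + m a`, and it forgets the POSITIONS and
RATIOS of the roots (the data carrying the spikes that make inversion false for general periodic spectra). -/
def IncType (t : ℕ) : Type := (Fin t → ℕ × ℕ) × (Fin t → Fin t → ℕ)

/-- The incidence type of `(a, b)` modulo `q`. -/
def incType (q : ℕ) (a b : Fin t → ℤ) : IncType t :=
  (fun i => (Int.gcd (a i) q, Int.gcd (b i) (Int.gcd (a i) q)),
   fun i j => Int.gcd (a i * b j - a j * b i) q)

/-- Band sum of a level-`Q` INCIDENCE SPECTRUM `f`: `Σ_{q ≤ Q} f(q, a, type_q(a,b))` — a sum over moduli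
`q ≤ Q` of functions of the system that see `b` only through its incidence type mod `q`. -/
def bandSum (Q : ℕ) (f : ℕ → (Fin t → ℤ) → IncType t → ℝ) (a b : Fin t → ℤ) : ℝ :=
  ∑ q ∈ Finset.Icc 1 Q, f q a (incType q a b)

/-- The level `⌊N^θ⌋`. -/
def level (θ : ℝ) (N : ℕ) : ℕ := ⌊(N : ℝ) ^ θ⌋₊

/-- The integer box `∏_i [u_i, u_i + X_i]` of shift vectors. -/
def box (u : Fin t → ℤ) (X : Fin t → ℕ) : Finset (Fin t → ℤ) :=
  Fintype.piFinset fun i => Finset.Icc (u i) (u i + X i)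

/-- Residue of an integer mod `q` as a natural number in `[0, q)` (junk `x.toNat` for `q = 0`). -/
def resid (q : ℕ) (x : ℤ) : ℕ := (x % (q : ℤ)).toNat

/-- The local factor of the coset `b ≡ c (q)`: `∏_{p ∣ q} β_p(a, c)` (for `b ≡ c (q)` the factors
`β_p(a, b)`, `p ∣ q`, are those of `(a, c)`). -/
def localTypeFactor (q : ℕ) (a c : Fin t → ℤ) : ℝ :=
  ∏ p ∈ q.primeFactors, localFactor (sys a c) p

/-! ### The statements -/

/-- ATOM P — the INCIDENCE-BANDLIMITED CORE at level `N^θ`. For all `t, L` there is `C` such that for every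
`ε > 0`, eventually in `N`, SOME level-`⌊N^θ⌋` incidence spectrum `f` (depending on `N`) satisfies, for every
non-degenerate `Ψ` with `‖Ψ‖_N ≤ L`: the a-priori bound `|M(Ψ)| ≤ C (𝔖(Ψ) + 1)` (what the uniform upper-bound
sieve gives in every world; it spares the line an XL sieve stub) and, for every convex `K ⊆ [-N, N]`,
`|S(Ψ,K) − β_∞(Ψ,K) M(Ψ)| ≤ ε (β_∞ |M(Ψ)| + N)` where `M(Ψ) = bandSum ⌊N^θ⌋ f (a, b)`. No singular series,
no main-term constant: the statement is existential in the spectrum. Implied by the crux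
(`core_of_relativeDimOne` + `stub_singularSeriesBandlimited`); monotone in `θ` (larger `θ` = weaker). -/
def IncidenceBandlimitedCore (θ : ℝ) : Prop :=
  ∀ (t L : ℕ), 1 ≤ t → ∃ C : ℝ, 0 < C ∧ ∀ ε : ℝ, 0 < ε → ∃ N₀ : ℕ, ∀ N : ℕ, N₀ ≤ N →
    ∃ f : ℕ → (Fin t → ℤ) → IncType t → ℝ,
      ∀ Ψ : Fin t → AffLinForm 1, IsNondegenerateSystem Ψ → affLinSize Ψ N ≤ L →
        |bandSum (level θ N) f (coeffs Ψ) (consts Ψ)| ≤ C * (singularProduct Ψ + 1) ∧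
        ∀ K : Set (Fin 1 → ℝ), Convex ℝ K → K ⊆ realBox 1 N →
          |vonMangoldtSum Ψ K N - archFactor Ψ K * bandSum (level θ N) f (coeffs Ψ) (consts Ψ)| ≤
            ε * (archFactor Ψ K * |bandSum (level θ N) f (coeffs Ψ) (consts Ψ)| + N)

/-- ATOM L — the SHARP CLASS SECOND MOMENT BELOW LEVEL `N^{θ₁}`: the tree's `SharpClassSecondMoment`
(individual-modulus Barban–Davenport–Halberstam with constant `1`) restricted to `q ≤ N^{θ₁}`. For `θ₁ < 1/2`
this is the classical `L`-function regime (GRH ⇒ it; open: Siegel zeros, zeros at `1 − C/log q`); the range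
`q > N^{1/2}` where no `L`-function tool exists is not asked for. -/
def LowClassSecondMoment (θ₁ : ℝ) : Prop :=
  ∀ ε : ℝ, 0 < ε → ∃ N₀ : ℕ, ∀ N : ℕ, N₀ ≤ N → ∀ q : ℕ, 1 ≤ q → (q : ℝ) ≤ (N : ℝ) ^ θ₁ →
    ∑ a ∈ Finset.range q, classPsi N q a ^ 2 ≤ (1 + ε) * ((N : ℝ) ^ 2 / Nat.totient q + N * Real.log N)

/-- MOVING MULTILINEAR CLASS MOMENTS below level `N^{θ₁}` — the prime side of the dictionary, typed in
exactly the shape `stub_inversion` consumes. For a modulus `q ≤ N^{θ₁}`, multipliers `0 < |a_i| ≤ L`,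
residues `c_i`, window lengths `X_i ≥ δN`, lower corners `u_i` and a range `n < W` (`W ≥ δN`) on which every
moving window `(a_i n + u_i − 1, a_i n + u_i + X_i]` sits at height in `[δN, LN]`:
`Σ_{n<W} ∏_i (ψ(a_i n+u_i+X_i; q, a_i n+c_i) − ψ(a_i n+u_i−1; q, a_i n+c_i))
   = (∏_i (X_i+1)/φ(q)^t) · #{n < W : gcd(a_i n + c_i, q) = 1 ∀ i} + O(ε W ∏_i (X_i+1)/φ(q)^t)`.
Summing `Λ(a_i n + b_i)` over the shifts `b ≡ c (q)` of the box `∏[u_i, u_i+X_i]` and over `n < W` IS the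
left side (substitute `x_i = a_i n + b_i`). From `LowClassSecondMoment θ₁'` for any `θ₁' > θ₁`
(`stub_classMoments`): class variance `o(x²/φ(q))` at each height `x ∈ [δN, LN]` by Cauchy–Schwarz against
PNT, `Σ_n |Δ_i(n)| ≤ √W (Σ_n Δ_i(n)²)^{1/2}` with the `n`-sum regrouped by `n mod q` (the class
`a_i n + c_i` is `gcd(a_i,q) ≤ L` to one, the height wobble `a_i r ≤ Lq` costs `O(L log N)`), the
Brun–Titchmarsh sup bound `≤ C X_i/φ(q)` for windows of length `≥ δN ≥ q^{1+ε}`, and telescoping. -/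
def MovingClassMoments (θ₁ : ℝ) : Prop :=
  ∀ (t L : ℕ), 1 ≤ t → ∀ δ ε : ℝ, 0 < δ → 0 < ε → ∃ N₀ : ℕ, ∀ N : ℕ, N₀ ≤ N →
    ∀ q : ℕ, 1 ≤ q → (q : ℝ) ≤ (N : ℝ) ^ θ₁ →
      ∀ a c u : Fin t → ℤ, (∀ i, a i ≠ 0 ∧ |a i| ≤ L) →
        ∀ X : Fin t → ℕ, (∀ i, δ * N ≤ (X i : ℝ)) →
          ∀ W : ℕ, δ * N ≤ W →
            (∀ i, ∀ n : ℕ, n < W →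
              δ * N + 1 ≤ ((a i * n + u i : ℤ) : ℝ) ∧ ((a i * n + u i + X i : ℤ) : ℝ) ≤ L * N) →
            |(∑ n ∈ Finset.range W,
                ∏ i, (classPsi (a i * n + u i + X i).toNat q (resid q (a i * n + c i))
                      - classPsi (a i * n + u i - 1).toNat q (resid q (a i * n + c i))))
              - (∏ i, ((X i : ℝ) + 1)) / (Nat.totient q : ℝ) ^ t *
                  (((Finset.range W).filter (fun n => ∀ i, Int.gcd (a i * n + c i) q = 1)).card : ℝ)|
              ≤ ε * W * (∏ i, ((X i : ℝ) + 1)) / (Nat.totient q : ℝ) ^ t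

/-- COSET SINGULAR MEANS below level `N^{θ₁}` (Gallagher 1976 / Goldston–Suriajaya 2021 Lemma 1 for
`t`-systems, uniform in the modulus): over the non-degenerate shifts `b ≡ c (q)` of a box with sides `≥ δN`
inside `[-LN, LN]^t`, `Σ 𝔖(a, b) = (∏_{p ∣ q} β_p(a, c)) · #{b in the box-coset} + O(ε (q/φ(q))^t #box/q^t)`,
for `q ≤ N^{θ₁}`. The pair/translate case along `h ≡ 0 (q)` is the tree's
`sum_goldbachSingularSeries_mul_le/ge` (PROVED, uniform in `q`). -/
def CosetSingularMean (θ₁ : ℝ) : Prop :=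
  ∀ (t L : ℕ), 1 ≤ t → ∀ δ ε : ℝ, 0 < δ → 0 < ε → ∃ N₀ : ℕ, ∀ N : ℕ, N₀ ≤ N →
    ∀ q : ℕ, 1 ≤ q → (q : ℝ) ≤ (N : ℝ) ^ θ₁ →
      ∀ a c u : Fin t → ℤ, (∀ i, a i ≠ 0) → (∑ i, |a i| ≤ L) →
        ∀ X : Fin t → ℕ, (∀ i, δ * N ≤ (X i : ℝ)) →
          (∀ i, -((L : ℝ) * N) ≤ u i ∧ (u i : ℝ) + X i ≤ L * N) →
          |(∑ b ∈ (box u X).filter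
                (fun b => (∀ i, Int.ModEq q (b i) (c i)) ∧ IsNondegenerateSystem (sys a b)),
              singularProduct (sys a b))
            - localTypeFactor q a c *
                (((box u X).filter (fun b => ∀ i, Int.ModEq q (b i) (c i))).card : ℝ)|
            ≤ ε * ((q : ℝ) / Nat.totient q) ^ t * (∏ i, ((X i : ℝ) + 1)) / (q : ℝ) ^ t

/-- THE SINGULAR SERIES IS INCIDENCE-BANDLIMITED at every power level, uniformly: eventually in `N` some
level-`⌊N^θ⌋` incidence spectrum `g` has `|𝔖(Ψ) − bandSum g| ≤ ε` for all non-degenerate `Ψ` of size `≤ L`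
(take `g(q, a, ·) = μ²(q) ∏_{p ∣ q} (β_p − 1)`, which factors through the incidence type; the tail
`Σ_{q > N^θ} μ²(q) ∏_{p∣q} |β_p − 1| ≤ N^{-θσ} exp(C_t Σ_{p ∣ Δ(Ψ)} p^{σ−1}) = o(1)` by Rankin, since
`|β_p − 1| ≤ C_t/p²` off the `O(log N/ log log N)` primes dividing `Δ(Ψ) = ∏ a_i ∏ D_ij` and `≤ C_t/p` on them). -/
def SingularSeriesBandlimited (θ : ℝ) : Prop :=
  ∀ (t L : ℕ), 1 ≤ t → ∀ ε : ℝ, 0 < ε → ∃ N₀ : ℕ, ∀ N : ℕ, N₀ ≤ N →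
    ∃ g : ℕ → (Fin t → ℤ) → IncType t → ℝ,
      ∀ Ψ : Fin t → AffLinForm 1, IsNondegenerateSystem Ψ → affLinSize Ψ N ≤ L →
        |singularProduct Ψ - bandSum (level θ N) g (coeffs Ψ) (consts Ψ)| ≤ ε

/-- INCIDENCE RIGIDITY (levels `θ < θ₁`): for all `t, L, C, δ, κ` there are `η > 0` and `N₀` such that for
`N ≥ N₀`, every incidence spectrum `e` of level `⌊N^θ⌋`, every coefficient vector `a` (`a_i ≠ 0`,
`Σ|a_i| ≤ L`) and every box `Ω = ∏ [ω_i, ω_i + Y]` (`Y ≥ N`) inside `[-LN, LN]^t`: IF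
(P) `|E(b)| ≤ C (𝔖(a,b) + 1)` for the non-degenerate `b ∈ Ω` (`E = bandSum e a`), and
(A) `|Σ_{b ∈ B, b ≡ c (q), non-deg} E(b)| ≤ η (q/φ(q))^{t+1} #B/q^t` for every modulus `q ≤ N^{θ₁}`, every
residue `c` and every sub-box `B ⊆ Ω` with sides `≥ δN`,
THEN `|E(b)| ≤ κ (𝔖(a,b) + 1)` for every non-degenerate `b` in the `δN`-interior of `Ω`.
Pure multiplicative harmonic analysis; NEW. Why plausible (pair/translate case, line card §Rigidity): the
box-coset data pin every Fourier coefficient of `E` at rationals of denominator `≤ N^θ` to absolute precision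
`O(η)` (near-orthogonality needs `θ + θ₁ < 1`); coherent spikes of an incidence-bandlimited function live
on shifts whose discriminants have many divisors among the moduli, where (P) caps them; the residual
"leak" telescopes down a divisor tree (`Σ_k (−1)^k k! S(n,k) = (−1)^n`) and is worth `O(η · polylog(1/η))`
to an adversary. FALSE for general periodic spectra and, at `t ≥ 3`, for affine-invariant ones (explicit
spikes in the file header) — whence the incidence class. Cheapest falsifier: the LP of the line card. -/
def IncidenceRigidity (θ θ₁ : ℝ) : Prop :=
  ∀ (t L : ℕ), 1 ≤ t → ∀ C δ κ : ℝ, 0 < δ → 0 < κ → ∃ η : ℝ, 0 < η ∧ ∃ N₀ : ℕ, ∀ N : ℕ, N₀ ≤ N →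
    ∀ e : ℕ → (Fin t → ℤ) → IncType t → ℝ, ∀ a : Fin t → ℤ, (∀ i, a i ≠ 0) → (∑ i, |a i| ≤ L) →
      ∀ ω : Fin t → ℤ, ∀ Y : ℕ, N ≤ Y → (∀ i, -((L : ℝ) * N) ≤ ω i ∧ (ω i : ℝ) + Y ≤ L * N) →
        (∀ b ∈ box ω (fun _ => Y), IsNondegenerateSystem (sys a b) →
            |bandSum (level θ N) e a b| ≤ C * (singularProduct (sys a b) + 1)) →
        (∀ q : ℕ, 1 ≤ q → (q : ℝ) ≤ (N : ℝ) ^ θ₁ → ∀ c u : Fin t → ℤ, ∀ X : Fin t → ℕ,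
            (∀ i, δ * N ≤ (X i : ℝ)) → (∀ i, ω i ≤ u i ∧ u i + X i ≤ ω i + Y) →
            |∑ b ∈ (box u X).filter
                  (fun b => (∀ i, Int.ModEq q (b i) (c i)) ∧ IsNondegenerateSystem (sys a b)),
                bandSum (level θ N) e a b|
              ≤ η * ((q : ℝ) / Nat.totient q) ^ (t + 1) * (∏ i, ((X i : ℝ) + 1)) / (q : ℝ) ^ t) →
        ∀ b : Fin t → ℤ, (∀ i, (ω i : ℝ) + δ * N ≤ b i ∧ (b i : ℝ) ≤ (ω i : ℝ) + Y - δ * N) →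
          IsNondegenerateSystem (sys a b) →
            |bandSum (level θ N) e a b| ≤ κ * (singularProduct (sys a b) + 1)

/-- THE INVERSION (deduction of the crux from the four inputs at matching levels). With `E := f − g`
(core spectrum minus singular-series spectrum, same level `θ`): (P) comes from the core's a-priori clause and
`|𝔖 − bandSum g| ≤ 1`; (A) comes from the DICTIONARY — for a box `B = ∏[u_i, u_i+X_i]` of shifts on which
every form is positive along the window `n ∈ [0, W)`, `W = δN`,
`Σ_{b ∈ B, b ≡ c (q)} S(a n + b, [0,W)) = Σ_{n<W} ∏_i (ψ(a_i n+u_i+X_i; q, a_i n+c_i) − ψ(a_i n+u_i−1; q, a_i n+c_i))`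
EXACTLY (substitute `x_i = a_i n + b_i`; degenerate `b` contribute `O(#B q log^t N/(δN))`), which
`MovingClassMoments` evaluates, while the core turns the left side into `W Σ_b M(b)` up to
`ε Σ_b (W|M(b)| + N)` and `CosetSingularMean` evaluates `Σ_b 𝔖(a,b)`; the two main terms agree because
`#{r mod q : gcd(a_i r + c_i, q) = 1 ∀ i} · q^{t−1}/φ(q)^t = ∏_{p∣q} β_p(a, c)`. `IncidenceRigidity` then gives
`|f − g| ≤ κ(𝔖 + 1)` on the interiors of the data boxes `{b : b_i ≥ 2δN (a_i > 0), b_i ≥ (|a_i|+2)δN (a_i < 0)}`;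
`incType` (hence `E`) is invariant under `b ↦ b + m a`, so every same-sign system and every mixed-sign system
whose positivity interval has length `G ≥ 6δN` is covered WITHOUT moving its sum, and
`|S − β_∞𝔖| ≤ |S − β_∞ M| + β_∞(|E| + |bandSum g − 𝔖|)` with `β_∞ ≤ 2N`; mixed-sign systems with `G < 6δN`
are re-read at the scale `N' = ⌈G/6δ⌉` after the translation `n ↦ n − m` of both `Ψ` and `K` (shifts `≤ N'`,
size `≤ L + 1`), or bounded trivially by `(G+1) log^t N ≤ εN` when `N' < N₀`. All inputs are uniform in `L`
(sizes grow to `≤ 3L²` inside the argument). Bookkeeping + the dictionary identity, M/L. -/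
def Inversion (θ θ₁ : ℝ) : Prop :=
  IncidenceBandlimitedCore θ → SingularSeriesBandlimited θ → MovingClassMoments θ₁ →
    CosetSingularMean θ₁ → IncidenceRigidity θ θ₁ → RelativeDimOne

end Summit.Parity.GeneralizedHardyLittlewood.Cruxes.RelativeDimOne.GallagherBackwardsSplit
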